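import Summits.BirchSwinnertonDyer.Rank1Residual.X11a.NormLamEndpoint
import Literature.NumberTheory.EllipticCurves.SteinWuthrich2013.MultiplicativeLeadingTerm
import Literature.NumberTheory.EllipticCurves.Rank1Residual.Typed.PAdicCertificateMultiplicative
import HarnessLib

/-!
# The unit-coefficient certificate at a multiplicative prime: `λ`-squeeze, the cyclotomic main
# conjecture at MINIMAL pairs, and `ord_{T=0} f_E = rank` (cell `b2b-bsdres`, instrument unit
# `b2b-bsdres-iw-1` — IWASAWA-INVARIANT CENSUS Part I, gen 2; kernel companion of
# HOME/IWASAWA-CENSUS.md §4.4 (1) and §4.6)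

HONEST FRAMING (run/shared/lean/b2b/bsd-rank1-residual/, verbatim in every file): prove what is
provable now; shrink each hard class to its core with data; no claim beyond stated classes. The goal
of the cell is to DELETE the COMBINATION-SHAPED residual classes of the Birch–Swinnerton-Dyer formula
for ALL analytic-rank `≤ 1` elliptic curves over `ℚ`, assembled STRICTLY from published theorems, so
that the rank-`≤ 1` remainder becomes exactly the CONSTRUCTION-SHAPED classes, which are TYPED
(missing-input `Prop`s), NOT attempted. This is not "finishing BSD". NO CLAIM BEYOND STATED CLASSES.
Theorems only, plus TWO `Prop`-valued certificate / typed-input shapes (`UnitCoeffAt`, `LamAlgGEAt`;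
nothing asserted); no named fact is introduced.

## What this file proves (the MINING compositions of the census, made kernel-hard)

The census (HOME/IWASAWA-CENSUS.md, 1663 residual pairs `(E, p)` at good-ordinary / multiplicative
`p` with `E[p]` irreducible) certifies per pair, with two independent engines, `μ_an(E,p) = 0` and
the `λ`-invariant `λ_an` of the Néron-normalised Mazur–Tate–Teitelbaum function `ϖ·L_p` — concretely:
the coefficient of index `λ_an` of `ϖ·L_p` is a `p`-ADIC UNIT and all earlier ones are non-units.
Its two "mining" compositions (§4.4 (1) "minimal pairs", §4.6 "squeeze") are proved here over the
tree's vocabulary (`X1.MuLambda.mu/lam`, `X11a.InvariantsAt`, `X2.MazurMainConjectureAt`):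

* §1 (pure algebra of `Λ = ℤ_p⟦T⟧`): the **squeeze** — if `fE ∣ g`, `g` has unit content (`μ(g) = 0`)
  and `λ(g) ≤ λ(fE)` then `(g) = (fE)` (`span_eq_span_of_dvd_of_lam_le`; Greenberg–Vatsal p. 4 with
  `X1.MuLambda.span_eq_span_iff_mu_le_and_lam_le`); `T^r ∣ fE ⇒ r ≤ λ(fE)` for unit-content `fE`
  (`le_lam_of_X_pow_dvd`); and the **minimal package**: `fE ∣ g`, unit content, `T^r ∣ fE`,
  `λ(g) ≤ r` ⇒ `(g) = (fE)`, `λ(fE) = λ(g) = r`, `ord_{T=0} fE = r` and `[T^r] fE ∈ ℤ_pˣ`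
  (`minimal_package`).
* §2 the per-pair certificate SHAPE `UnitCoeffAt W p n` ("the coefficient of index `n + e` of
  `ϖ·L_p` is a `p`-adic unit", `e = 1` at split `p`, else `0`; a `Prop`, nothing asserted — the datum
  of `certs/iw/<label>@<p>.json` with `n + e = λ_an`), which refines x11a's `MuAnZeroAt`
  (`muAnZeroAt_of_unitCoeffAt`) and gives `λ(gK) ≤ n` with unit content at every Kato pair
  (`invariantsAt_of_unitCoeffAt`); and the typed LOWER-BOUND shape `LamAlgGEAt W p n`
  ("`n ≤ λ(fE)` for every generator `fE` of `char_Λ X(E/ℚ_∞)` at a Kato pair"; nothing asserted —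
  the census's structural bound `LB − e`, whose published mechanism (Greenberg LNM 1716 Cor. 5.6 run up
  the cyclotomic tower) is NOT in the tree; at `n = rank E(ℚ)` it is a THEOREM here,
  `lamAlgGEAt_mordellWeilRank`, by `T^r ∣ fE`).
* §3 at a multiplicative prime `p ≠ 2` with `ρ_{E,p^∞}` surjective (every `ρ̄_{E,p^n}` onto: `p ≥ 5`
  from `ρ̄_{E,p}` onto by Serre, `p = 3` by Wuthrich's Lemma 20 since `9 ∤ N`), Kato's divisibility
  (`Wuthrich2014.kato_charIdeal_dvd_multiplicative_of_surjective`, hypothesis `hKato`) and: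
  - SQUEEZE: `UnitCoeffAt W p n ∧ LamAlgGEAt W p n ⇒` Mazur's main conjecture at `(E,p)`
    (`mazurMainConjectureAt_of_unitCoeffAt_of_lamAlgGEAt`; census §4.6: 1344 Kato-integral pairs with
    `λ_an = LB`, conditional on the typed bound at `n = LB − e > r`);
  - MINIMAL PAIRS: `UnitCoeffAt W p (rank E(ℚ)) ⇒` Mazur's main conjecture at `(E,p)` AND, for every
    dual datum and generator, `ord_{T=0} f_E = rank E(ℚ)` with unit leading coefficient
    (`invariantsAt_of_unitCoeffAt_mordellWeilRank`, `mazurMainConjectureAt_of_unitCoeffAt_mordellWeilRank`;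
    census §4.4 (1): 1081 pairs, 435 of analytic rank `1`), hence by Stein–Wuthrich Thm. 6.1 clause 2
    (named facts `thm61_splitMultiplicative` / `thm61_nonsplitMultiplicative`, hypotheses) Schneider's
    conjecture for THE canonical height and finiteness of `Ш(E/ℚ)[p^∞]` at the pair
    (`schneider_and_finite_sha_of_unitCoeffAt_split` / `_nonsplit`) — NO `p`-adic regulator is
    computed (contrast the lane's `Typed.PAdicCertificateEngine`, whose `hcert` is a regulator
    valuation); analytic-rank versions via Gross–Zagier–Kolyvagin (`hGZK`).
  This is the Stein–Wuthrich "unit quotient" remark (Math. Comp. 82 (2013) p. 29: same order of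
  vanishing and same leading valuation ⇒ the Kato quotient is a unit in `ℤ_p⟦T⟧`) in the `(μ, λ)` form of
  Greenberg–Vatsal p. 4; the census's contribution is the certified unit coefficient, pair by pair.

References: [GreenbergVatsal2000] (1)–(2), p. 4; [SteinWuthrich2013] Thm. 6.1 (p. 20), §11 remark
(p. 29); [Wuthrich2014] Thm. 3, Cor. 19 (p. 399), Lemma 20 (p. 399); [Washington1997] §7.1;
[GreenbergLNM1716] §3 Lemma 3.1, Cor. 5.6; HOME/IWASAWA-CENSUS.md §4.4, §4.6 (rev. 2).

FILE SPLIT (gate rule: cell-topic files ≤ 400 lines; filed by the prover seat multr1-p2 gen 4 at the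
iw-1 seat's request, `b2b-bsdres-iw-1/lean/HANDOVER.md`, content UNCHANGED): this module holds §1 and
§2; §3 (the multiplicative prime: Kato + certificate, squeeze, minimal pairs, Schneider ∧ `Ш[p^∞]`
finite, the image hypotheses) is `Iwasawa/UnitCoefficientCertificateMultiplicative.lean`.
-/

noncomputable section

open scoped Classical MatrixGroups ModularForm

open CongruenceSubgroup WeierstrassCurve Literature.NumberTheory.EllipticCurves
  Literature.NumberTheory.EllipticCurves.ModularForms
  Literature.NumberTheory.EllipticCurves.Rank1Residual
  Literature.NumberTheory.EllipticCurves.Rank1Residual.Typed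
  Literature.NumberTheory.EllipticCurves.Wuthrich2014
  Literature.NumberTheory.EllipticCurves.GreenbergVatsal2000
  Literature.NumberTheory.EllipticCurves.SteinWuthrich2013
  Summit.BirchSwinnertonDyer.Rank1Residual.X1.MuLambda
  Summit.BirchSwinnertonDyer.Rank1Residual.X11a
  Summit.BirchSwinnertonDyer.Rank1Residual.X11a.LambdaNorm

set_option autoImplicit false

namespace Summit.BirchSwinnertonDyer.Rank1Residual.Iwasawa

/-! ## §1. Pure algebra in `Λ = ℤ_p⟦T⟧`: the squeeze and the minimal package -/

section Algebra

variable {p : ℕ} [Fact p.Prime]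

/-- Unit content is insensitive to a factor `T^r`. [folklore] -/
theorem hasUnitContent_X_pow_mul_iff (q : IwasawaAlgebra p) (r : ℕ) :
    HasUnitContent ((PowerSeries.X : IwasawaAlgebra p) ^ r * q) ↔ HasUnitContent q := by
  induction r with
  | zero => simp
  | succ r ih => rw [pow_succ', mul_assoc, EmertonPollackWeston2006.hasUnitContent_X_mul_iff, ih]

/-- `λ(T^r · q) = λ(q) + r` for `q` of unit content (`λ = normLam` on unit-content series and
`normLam` shifts by `r`). [cite: Washington1997, §7.1] -/
theorem lam_X_pow_mul {q : IwasawaAlgebra p} (hq : HasUnitContent q) (r : ℕ) :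
    lam ((PowerSeries.X : IwasawaAlgebra p) ^ r * q) = lam q + r := by
  have hq' : ∃ n, ‖PowerSeries.coeff n q‖ = 1 := (hasUnitContent_iff_exists_norm_eq_one q).mp hq
  have h0 : ∃ n, ‖PowerSeries.coeff n q‖ ≠ 0 := by
    obtain ⟨n, hn⟩ := hq'
    exact ⟨n, by rw [hn]; exact one_ne_zero⟩
  rw [lam_eq_normLam ((hasUnitContent_X_pow_mul_iff q r).mpr hq), lam_eq_normLam hq,
    normLam_X_pow_mul (hasMaxCoeff_of_exists_norm_eq_one hq') h0 r]

/-- **`T^r ∣ f ⇒ r ≤ λ(f)`** for `f ∈ Λ` of unit content (the order of vanishing at `T = 0` of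
`f mod p` is at least that of `f`). [cite: Washington1997, §7.1] -/
theorem le_lam_of_X_pow_dvd {f : IwasawaAlgebra p} (hf : HasUnitContent f) {r : ℕ}
    (h : (PowerSeries.X : IwasawaAlgebra p) ^ r ∣ f) : r ≤ lam f := by
  obtain ⟨q, rfl⟩ := h
  rw [lam_X_pow_mul ((hasUnitContent_X_pow_mul_iff q r).mp hf) r]
  exact Nat.le_add_left r _

/-- **The `λ`-squeeze** (Greenberg–Vatsal p. 4 in one-inequality form): if `fE ∣ g` in `Λ`, `g` has
unit content (`μ(g) = 0`) and `λ(g) ≤ λ(fE)`, then `(g) = (fE)` — the cofactor has `μ = λ = 0`, i.e.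
is a unit. With Kato's divisibility `g ∈ (fE) = char_Λ X` this is the main conjecture at the pair.
[cite: GreenbergVatsal2000, p. 4 (after Thm. (1.2))] -/
theorem span_eq_span_of_dvd_of_lam_le {fE g : IwasawaAlgebra p} (hg : HasUnitContent g)
    (hdvd : fE ∣ g) (hle : lam g ≤ lam fE) :
    Ideal.span ({g} : Set (IwasawaAlgebra p)) = Ideal.span {fE} := by
  obtain ⟨h, hfac⟩ := hdvd
  have hg0 : g ≠ 0 := ne_zero_of_hasUnitContent hg
  have hfE0 : fE ≠ 0 := by
    rintro rfl
    exact hg0 (by rw [hfac, zero_mul])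
  exact (span_eq_span_iff_mu_le_and_lam_le hfE0 hg0 hfac).mpr
    ⟨by rw [mu_eq_zero_of_hasUnitContent hg]; exact Nat.zero_le _, hle⟩

/-- The squeeze, cofactor form: `g = fE · h` with `g` of unit content and `λ(g) ≤ λ(fE)` forces
`h ∈ Λˣ`. [cite: GreenbergVatsal2000, p. 4 (after Thm. (1.2))] -/
theorem isUnit_of_mul_eq_of_lam_le {fE g h : IwasawaAlgebra p} (hg : HasUnitContent g)
    (hfac : g = fE * h) (hle : lam g ≤ lam fE) : IsUnit h := by
  have hg0 : g ≠ 0 := ne_zero_of_hasUnitContent hg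
  have hfE0 : fE ≠ 0 := by
    rintro rfl
    exact hg0 (by rw [hfac, zero_mul])
  exact (span_eq_span_iff_isUnit hfE0 hfac).mp (span_eq_span_of_dvd_of_lam_le hg ⟨h, hfac⟩ hle)

/-- A unit-content series with `λ = 0` has unit constant term. [cite: Washington1997, §7.1] -/
theorem isUnit_constantCoeff_of_lam_eq_zero {q : IwasawaAlgebra p} (hq : HasUnitContent q)
    (h0 : lam q = 0) : IsUnit (PowerSeries.constantCoeff q) := by
  have hq' : ∃ n, ‖PowerSeries.coeff n q‖ = 1 := (hasUnitContent_iff_exists_norm_eq_one q).mp hq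
  have h1 : ‖PowerSeries.coeff (normLam q) q‖ = 1 := norm_coeff_normLam_eq_one hq'
  rw [← lam_eq_normLam hq, h0, PowerSeries.coeff_zero_eq_constantCoeff] at h1
  exact PadicInt.isUnit_iff.mpr h1

/-- **The minimal package.** If `fE ∣ g` in `Λ`, `g` has unit content, `T^r ∣ fE` and `λ(g) ≤ r`,
then `(g) = (fE)`, `λ(fE) = λ(g) = r`, `μ(fE) = μ(g) = 0`, `ord_{T=0} fE = r` and the leading
coefficient `[T^r] fE` is a unit of `ℤ_p`: `r ≤ λ(fE) ≤ λ(g) ≤ r` squeezes, and `fE = T^r · q` with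
`λ(q) = 0`, i.e. `q(0) ∈ ℤ_pˣ`. (Census §4.4 (1): `L_p = T^{r+e}·(unit)` forces `f_E ~ T^r`.)
[cite: GreenbergVatsal2000, p. 4 (after Thm. (1.2))] [cite: SteinWuthrich2013, §11 remark (p. 29)] -/
theorem minimal_package {fE g : IwasawaAlgebra p} (hg : HasUnitContent g) (hdvd : fE ∣ g) {r : ℕ}
    (hX : (PowerSeries.X : IwasawaAlgebra p) ^ r ∣ fE) (hle : lam g ≤ r) :
    Ideal.span ({g} : Set (IwasawaAlgebra p)) = Ideal.span {fE} ∧ lam fE = r ∧ lam g = r ∧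
      mu fE = 0 ∧ mu g = 0 ∧ fE.order = r ∧ IsUnit (PowerSeries.coeff r fE) := by
  obtain ⟨h, hfac⟩ := hdvd
  have hg0 : g ≠ 0 := ne_zero_of_hasUnitContent hg
  have hfE : HasUnitContent fE := hasUnitContent_left_of_mul (a := fE) (b := h) (hfac ▸ hg)
  have hfE0 : fE ≠ 0 := ne_zero_of_hasUnitContent hfE
  have hh0 : h ≠ 0 := by
    rintro rfl
    exact hg0 (by rw [hfac, mul_zero])
  have h1 : r ≤ lam fE := le_lam_of_X_pow_dvd hfE hX
  have h2 : lam fE ≤ lam g := by rw [hfac]; exact lam_le_lam_mul hfE0 hh0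
  have hlamfE : lam fE = r := le_antisymm (h2.trans hle) h1
  have hlamg : lam g = r := le_antisymm hle (h1.trans h2)
  have hspan : Ideal.span ({g} : Set (IwasawaAlgebra p)) = Ideal.span {fE} :=
    span_eq_span_of_dvd_of_lam_le hg ⟨h, hfac⟩ (by rw [hlamfE, hlamg])
  -- `fE = T^r · q` with `q(0)` a unit
  obtain ⟨q, hq⟩ := hX
  have hqc : HasUnitContent q := (hasUnitContent_X_pow_mul_iff q r).mp (hq ▸ hfE)
  have hlamq : lam q = 0 := by
    have := lam_X_pow_mul hqc r
    rw [← hq, hlamfE] at this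
    omega
  have hunit : IsUnit (PowerSeries.constantCoeff q) := isUnit_constantCoeff_of_lam_eq_zero hqc hlamq
  have hcoeff : PowerSeries.coeff r fE = PowerSeries.constantCoeff q := by
    rw [hq, ← PowerSeries.coeff_zero_eq_constantCoeff_apply, ← PowerSeries.coeff_X_pow_mul q r 0,
      zero_add]
  have hord : fE.order = r := by
    rw [PowerSeries.order_eq_nat]
    refine ⟨by rw [hcoeff]; exact hunit.ne_zero, fun i hi => ?_⟩
    rw [hq, PowerSeries.coeff_X_pow_mul', if_neg (not_le.mpr hi)]
  exact ⟨hspan, hlamfE, hlamg, mu_eq_zero_of_hasUnitContent hfE, mu_eq_zero_of_hasUnitContent hg,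
    hord, hcoeff ▸ hunit⟩

end Algebra

/-! ## §2. The certificate shape `UnitCoeffAt` and the typed lower bound `LamAlgGEAt` -/

section Shapes

variable (W : WeierstrassCurve ℚ) [W.IsElliptic] [W.IsGloballyMinimal] (p : ℕ) [Fact p.Prime]

/-- **The per-pair unit-coefficient certificate at a multiplicative prime** (a `Prop`; nothing
asserted; a finite modular-symbol computation — the datum of the census certificate
`certs/iw/<label>@<p>.json`, two independent engines): for every newform `f` of `W` and every
`ϖ ∈ ℚ` with `ϖ·Ω_E = Ω⁺_f`, the coefficient of index `n` (non-split `p`), resp. `n + 1` (split `p`: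
the trivial zero), of the Néron-normalised Mazur–Tate–Teitelbaum series `ϖ·L_p` — THE non-split
function `IsMultPAdicLFunctionOf f p (-1)`, resp. THE split one `IsSplitMultPAdicLFunctionOf` — is a
`p`-adic unit. It says `μ_an(E,p) = 0` and `λ_an(E,p) ≤ n + e`; the census records it with
`n + e = λ_an` ("minimal pair": `n = r_an(E)`). Same binder shape as x11a's `MuAnZeroAt` (which is
`∃ n, UnitCoeffAt`-like). [cite: GreenbergVatsal2000, p. 2–3, (2) and "λ_anal, μ_anal" (shape only; nothing asserted)]
[cite: SteinWuthrich2013, §3 and §11 remark (p. 29) (shape only; nothing asserted)] -/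
def UnitCoeffAt (n : ℕ) : Prop :=
  ∀ {N : ℕ} [NeZero N] (f : CuspForm (Gamma0 N) 2), IsNewformOf W f →
    ∀ (ϖ : ℚ), (ϖ : ℝ) * W.realPeriodRat = plusPeriod f →
      (¬ W.HasSplitMultiplicativeReductionAtPrime p →
        ∀ L : PowerSeries ℚ_[p], IsMultPAdicLFunctionOf f p (-1) L →
          ‖PowerSeries.coeff n (PowerSeries.C ((ϖ : ℚ) : ℚ_[p]) * L)‖ = 1) ∧
      (W.HasSplitMultiplicativeReductionAtPrime p →
        ∀ L : PowerSeries ℚ_[p], IsSplitMultPAdicLFunctionOf f p L →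
          ‖PowerSeries.coeff (n + 1) (PowerSeries.C ((ϖ : ℚ) : ℚ_[p]) * L)‖ = 1)

/-- **Typed lower bound for `λ_alg` at the pair** (a `Prop`; nothing asserted): `n ≤ λ(fE)` for
every generator `fE` of `char_Λ X(E/ℚ_∞)` at every Kato pair (binder shape of `X11a.InvariantsAt`).
At `n = rank E(ℚ)` it is a theorem (`lamAlgGEAt_mordellWeilRank`, from `T^r ∣ fE`); the census's
structural bound `LB − e` (Tamagawa numbers up the cyclotomic tower, anomalous `p`, the
`𝓛`-invariant — Greenberg's proof of LNM 1716 Cor. 5.6 run over the layers `ℚ_m`) is its intended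
larger instance and is NOT a tree theorem: it enters only through this hypothesis.
[cite: GreenbergLNM1716, Cor. 5.6 (p. 136) and Prop. 3.10 (shape only; nothing asserted)] -/
def LamAlgGEAt (n : ℕ) : Prop :=
  InvariantsAt W p fun _ fE => n ≤ lam fE

variable {W p}

/-- The unit-coefficient certificate refines x11a's `μ_an(E,p) = 0` certificate. [folklore] -/
theorem muAnZeroAt_of_unitCoeffAt {n : ℕ} (h : UnitCoeffAt W p n) : MuAnZeroAt W p := by
  intro N _ f hf ϖ hϖ
  obtain ⟨hns, hs⟩ := h f hf ϖ hϖ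
  exact ⟨fun h' L hL => ⟨n, hns h' L hL⟩, fun h' L hL => ⟨n + 1, hs h' L hL⟩⟩

/-- Reading a unit coefficient of `ι(T^e · g) = ϖ·L` on `g`: `‖[T^n] g‖ = 1`. [folklore] -/
theorem norm_coeff_eq_one_of_iota_X_pow_mul_eq {g : IwasawaAlgebra p} {F : PowerSeries ℚ_[p]}
    (e n : ℕ) (h : iwasawaToPowerSeries p ((PowerSeries.X : IwasawaAlgebra p) ^ e * g) = F)
    (hn : ‖PowerSeries.coeff (n + e) F‖ = 1) : ‖PowerSeries.coeff n g‖ = 1 := by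
  rw [← h, iwasawaToPowerSeries, PowerSeries.coeff_map, PowerSeries.coeff_X_pow_mul] at hn
  simpa using hn

/-- **The certificate in `Λ`-terms**: `UnitCoeffAt W p n` gives, at every Kato pair `(fE, g)`
(`ι(T^e g) = ϖ·L_p`), unit content of `g` and `λ(g) ≤ n` (`‖[T^n] g‖ = 1`, so `n` is an index of
maximal norm and `λ = normLam ≤ n`). No hypothesis on the pair. [cite: GreenbergVatsal2000, p. 2–3, (1)–(2)] -/
theorem invariantsAt_of_unitCoeffAt {n : ℕ} (h : UnitCoeffAt W p n) :
    InvariantsAt W p fun g _ => HasUnitContent g ∧ lam g ≤ n := by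
  intro κ γ hκ hγ hγ' N _ f hf D ϖ hϖ fE g hchar
  have key : ∀ e : ℕ, ∀ F : PowerSeries ℚ_[p],
      iwasawaToPowerSeries p ((PowerSeries.X : IwasawaAlgebra p) ^ e * g) = F →
      ‖PowerSeries.coeff (n + e) F‖ = 1 → HasUnitContent g ∧ lam g ≤ n := by
    intro e F hι hn
    have h1 : ‖PowerSeries.coeff n g‖ = 1 := norm_coeff_eq_one_of_iota_X_pow_mul_eq e n hι hn
    have hg : HasUnitContent g := (hasUnitContent_iff_exists_norm_eq_one g).mpr ⟨n, h1⟩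
    refine ⟨hg, ?_⟩
    rw [lam_eq_normLam hg]
    exact normLam_le_of_isMaxCoeffAt (isMaxCoeffAt_of_norm_eq_one h1)
  obtain ⟨hns, hs⟩ := h f hf ϖ hϖ
  refine ⟨fun h' L hL hι => key 0 _ (by simpa using hι) (by simpa using hns h' L hL),
    fun h' L hL hι => key 1 _ (by simpa using hι) (hs h' L hL)⟩

end Shapes


end Summit.BirchSwinnertonDyer.Rank1Residual.Iwasawa

end
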